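import Literature.AlgebraicGeometry.Motives.MumfordTateInvariantsXiHodge
import Literature.AlgebraicGeometry.Motives.AtypicalHodgeLocus
import HarnessLib

/-!
# The Mumford–Tate Lie algebra acts by infinitesimal similitudes of a polarization: `𝔪𝔱(H) ⊆ 𝔤𝔰𝔭(Q)` / `𝔤𝔬(Q)`

Family `hodge`, layer `Literature/AlgebraicGeometry/Motives`.  Theorems only; no definition, no named fact.  Written for the
cell `pub-hodgecm2` (COR-CM), seat `b27` gen 35 (count-neutral; the Lie-algebra companion of the tree's group-level
`Polarization.exists_similitude_of_mem_mumfordTateGroup`, `MumfordTateInvariantsXiHodge`: `MT(H)(ℚ) ⊆ GSp(Q)`).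

For a pure `ℚ`-Hodge structure `H` of weight `n` on a finite-dimensional `V` with polarization `Q`, and `X` in the Mumford–Tate
Lie algebra `𝔪𝔱(H) = H.mumfordTateLieAlgebra` (the annihilator, under the derivation action, of the weight-`0` Hodge tensors of
type `(0,0)`, `Motives/AtypicalHodgeLocus`):

* `evalTwo_tensorPowerDeriv` — the rank-two evaluation functional against the Leibniz action:
  `⟨φ ⊗ ψ, D₂(X) x⟩ = ⟨(φ ∘ X) ⊗ ψ, x⟩ + ⟨φ ⊗ (ψ ∘ X), x⟩`;
* `Polarization.eval_tensorSpaceDeriv_xiTensor` — the derivation action on the weight-`0` Hodge tensor `Ξ = q' ⊗ q ∈ T^{2,2}`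
  (`q` the tensor of `Q`, `q'` that of the inverse form `Q^∨`), evaluated:
  `⟨…, ρ(X) Ξ⟩ = (Q^∨(φ ∘ X, ψ) + Q^∨(φ, ψ ∘ X)) · Q(v, w) − Q^∨(φ, ψ) · (Q(X v, w) + Q(v, X w))`;
* **`Polarization.exists_form_add_form_eq_mul_of_mem_mumfordTateLieAlgebra`** — `X ∈ 𝔪𝔱(H)` ⟹ there is `c ∈ ℚ` with
  `Q(X v, w) + Q(v, X w) = c · Q(v, w)` for all `v, w` (**`𝔪𝔱 ⊆ 𝔤𝔰𝔭(Q)`**, the differential of Deligne's `MT ⊆ GSp(Q)`,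
  LNM 900, I Prop. 3.6 proof: `Q` is a morphism `V ⊗ V → ℚ(−n)`);
* **`Polarization.exists_sub_smul_id_skew_of_mem_mumfordTateLieAlgebra`** — hence `X − (c/2)·id` is `Q`-skew, and for `n ≠ 0`
  it again lies in `𝔪𝔱(H)` (`id ∈ 𝔪𝔱`, `id_mem_mumfordTateLieAlgebra`): `𝔪𝔱 = (𝔪𝔱 ∩ 𝔰𝔭(Q)) + ℚ·id`.

## References
* [Deligne1982HodgeCycles] P. Deligne, *Hodge cycles on abelian varieties*, LNM 900 (1982), I §3, Prop. 3.4 and Prop. 3.6 (proof).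
  [cite: Deligne1982HodgeCycles, I Prop. 3.6 (proof)]
* [GreenGriffithsKerr2012] M. Green, P. Griffiths, M. Kerr, *Mumford–Tate groups and domains* (2012), (I.B.6).
* [Huybrechts2016K3] D. Huybrechts, *Lectures on K3 Surfaces*, Thm. 3.3.9 (proof). [cite: Huybrechts2016K3, Thm. 3.3.9 (proof, p. 67)]
-/

noncomputable section

open scoped TensorProduct
open PiTensorProduct

namespace Literature.AlgebraicGeometry.Motives

namespace HodgeStructure

universe u

variable {V : Type u} [AddCommGroup V] [Module ℚ V] [Module.Finite ℚ V] {n : ℤ} {H : HodgeStructure V n}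

/-! ### The rank-two evaluation functional against the Leibniz action -/

section EvalTwoDeriv

variable {M : Type u} [AddCommGroup M] [Module ℚ M]

/-- **`⟨φ ⊗ ψ, D₂(X) x⟩ = ⟨(φ ∘ X) ⊗ ψ, x⟩ + ⟨φ ⊗ (ψ ∘ X), x⟩`** for the Leibniz action `D₂(X)` of `X ∈ End(M)` on `M^{⊗2}`
(`tensorPowerDeriv`, the differential of `g ↦ g ⊗ g`, Deligne I §3.1; on `x₀ ⊗ x₁`: `φ(X x₀) ψ(x₁) + φ(x₀) ψ(X x₁)`).
[cite: Deligne1982HodgeCycles, I §3.1] -/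
theorem evalTwo_tensorPowerDeriv (φ ψ : Module.Dual ℚ M) (X : Module.End ℚ M) (x : ⨂[ℚ]^2 M) :
    evalTwo φ ψ (tensorPowerDeriv M 2 X x) = evalTwo (φ ∘ₗ X) ψ x + evalTwo φ (ψ ∘ₗ X) x := by
  induction x using PiTensorProduct.induction_on with
  | smul_tprod r v =>
    have h10 : (1 : Fin 2) ≠ 0 := by decide
    have h01 : (0 : Fin 2) ≠ 1 := by decide
    simp only [map_smul, tensorPowerDeriv_tprod, Fin.sum_univ_two, map_add, evalTwo_tprod, LinearMap.comp_apply,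
      smul_eq_mul, Function.update_self, Function.update_of_ne h10, Function.update_of_ne h01]
    ring
  | add x y hx hy => rw [map_add, map_add, map_add, map_add, hx, hy]; abel

end EvalTwoDeriv

/-! ### `ρ(X) Ξ` evaluated, and `𝔪𝔱 ⊆ 𝔤𝔰𝔭(Q)` -/

/-- `⟨φ ⊗ ψ, q'⟩ = Q^∨(φ, ψ)` for the tensor `q'` of the inverse form `Q^∨` (the tensor of the morphism `V^∨ ⊗ V^∨ → ℚ(n)`,
Deligne I Prop. 3.6 proof). [cite: Deligne1982HodgeCycles, I Prop. 3.6 (proof)] -/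
theorem Polarization.evalTwo_dualFormTensor (Q : Polarization H) (φ ψ : Module.Dual ℚ V) :
    evalTwo φ ψ Q.dualFormTensor = Q.dualForm φ ψ := by
  classical
  have h := evalTwo_sum_sum_smul_tprod (Module.finBasis ℚ V) Q.dualForm φ ψ LinearMap.id
  simp only [LinearMap.comp_id] at h
  rw [Polarization.dualFormTensor]
  convert h using 2

/-- `⟨ev_v ⊗ ev_w, q⟩ = Q(v, w)` for the tensor `q` of the form (the tensor of the morphism `Q : V ⊗ V → ℚ(−n)`, Deligne I
Prop. 3.6 proof). [cite: Deligne1982HodgeCycles, I Prop. 3.6 (proof)] -/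
theorem Polarization.evalTwo_eval_formTensor (Q : Polarization H) (v w : V) :
    evalTwo (Module.Dual.eval ℚ V v) (Module.Dual.eval ℚ V w) Q.formTensor = Q.form v w := by
  classical
  have h := evalTwo_eval_sum_sum_smul_tprod (Module.finBasis ℚ V) Q.form v w LinearMap.id
  simp only [LinearMap.comp_id, LinearMap.id_apply] at h
  rw [Polarization.formTensor]
  exact h

omit [Module.Finite ℚ V] in
/-- `ev_v ∘ Xᵀ = ev_{X v}` on `V^∨` (private plumbing). [folklore] -/
private theorem eval_comp_dualMap (X : Module.End ℚ V) (v : V) :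
    Module.Dual.eval ℚ V v ∘ₗ (X.dualMap : Module.End ℚ (Module.Dual ℚ V)) = Module.Dual.eval ℚ V (X v) := by
  refine LinearMap.ext fun φ => ?_
  rfl

/-- **The derivation action on `Ξ = q' ⊗ q`, evaluated**: for all `φ, ψ ∈ V^∨`, `v, w ∈ V`,
`⟨(φ ⊗ ψ) ⊗ (ev_v ⊗ ev_w), ρ(X) Ξ⟩ = (Q^∨(φ ∘ X, ψ) + Q^∨(φ, ψ ∘ X)) · Q(v, w) − Q^∨(φ, ψ) · (Q(X v, w) + Q(v, X w))`
(`ρ(X)(q' ⊗ q) = D₂(X) q' ⊗ q − q' ⊗ D₂(Xᵀ) q`). [cite: Deligne1982HodgeCycles, I §3.1 and Prop. 3.6 (proof)] -/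
theorem Polarization.eval_tensorSpaceDeriv_xiTensor (Q : Polarization H) (X : Module.End ℚ V)
    (φ ψ : Module.Dual ℚ V) (v w : V) :
    (LinearMap.mul' ℚ ℚ ∘ₗ TensorProduct.map (evalTwo φ ψ)
        (evalTwo (Module.Dual.eval ℚ V v) (Module.Dual.eval ℚ V w))) (tensorSpaceDeriv V 2 2 X Q.xiTensor) =
      (Q.dualForm (φ ∘ₗ X) ψ + Q.dualForm φ (ψ ∘ₗ X)) * Q.form v w -
        Q.dualForm φ ψ * (Q.form (X v) w + Q.form v (X w)) := by
  rw [Polarization.xiTensor, tensorSpaceDeriv_tmul, map_sub, LinearMap.comp_apply, LinearMap.comp_apply,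
    TensorProduct.map_tmul, TensorProduct.map_tmul, LinearMap.mul'_apply, LinearMap.mul'_apply,
    evalTwo_tensorPowerDeriv, evalTwo_tensorPowerDeriv, eval_comp_dualMap, eval_comp_dualMap,
    Q.evalTwo_dualFormTensor, Q.evalTwo_dualFormTensor, Q.evalTwo_dualFormTensor, Q.evalTwo_eval_formTensor,
    Q.evalTwo_eval_formTensor, Q.evalTwo_eval_formTensor]

variable [HodgeTensorFacts.{u, u}]

/-- **Key identity for `X ∈ 𝔪𝔱(H)`**: `Q^∨(φ, ψ) · (Q(X v, w) + Q(v, X w)) = (Q^∨(φ ∘ X, ψ) + Q^∨(φ, ψ ∘ X)) · Q(v, w)` for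
all `φ, ψ, v, w` — `ρ(X)` kills the weight-`0` Hodge tensor `Ξ` of type `(0,0)` (`Polarization.xiTensor_mem_hodgeClasses`).
[cite: Deligne1982HodgeCycles, I Prop. 3.6 (proof)] -/
theorem Polarization.dualForm_mul_form_add_eq_of_mem_mumfordTateLieAlgebra (Q : Polarization H) {X : Module.End ℚ V}
    (hX : X ∈ H.mumfordTateLieAlgebra) (φ ψ : Module.Dual ℚ V) (v w : V) :
    Q.dualForm φ ψ * (Q.form (X v) w + Q.form v (X w)) = (Q.dualForm (φ ∘ₗ X) ψ + Q.dualForm φ (ψ ∘ₗ X)) * Q.form v w := by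
  have h0 : tensorSpaceDeriv V 2 2 X Q.xiTensor = 0 :=
    (H.mem_mumfordTateLieAlgebra_iff X).1 hX 2 2 (by ring) _ Q.xiTensor_mem_hodgeClasses
  have h := Q.eval_tensorSpaceDeriv_xiTensor X φ ψ v w
  rw [h0, map_zero] at h
  linear_combination h

/-- **`𝔪𝔱(H) ⊆ 𝔤𝔰𝔭(Q)` (resp. `𝔤𝔬(Q)`): the Mumford–Tate Lie algebra acts by infinitesimal similitudes of every polarization** —
for `X ∈ 𝔪𝔱(H)` there is `c ∈ ℚ` with `Q(X v, w) + Q(v, X w) = c · Q(v, w)` for all `v, w`; the differential at `1` of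
`Q(g v, g w) = ν(g) Q(v, w)` for `g ∈ MT(H)` (Deligne: `Q : V ⊗ V → ℚ(−n)` is a morphism of Hodge structures, so `MT` acts on the
line `ℚ(−n)` through a character). [cite: Deligne1982HodgeCycles, I Prop. 3.6 (proof)] [cite: Huybrechts2016K3, Thm. 3.3.9 (proof, p. 67)] -/
theorem Polarization.exists_form_add_form_eq_mul_of_mem_mumfordTateLieAlgebra (Q : Polarization H) {X : Module.End ℚ V}
    (hX : X ∈ H.mumfordTateLieAlgebra) : ∃ c : ℚ, ∀ v w, Q.form (X v) w + Q.form v (X w) = c * Q.form v w := by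
  by_cases hQ : ∀ v w : V, Q.form v w = 0
  · refine ⟨0, fun v w => ?_⟩
    rw [hQ, hQ, hQ, mul_zero, add_zero]
  simp only [not_forall] at hQ
  obtain ⟨v₀, w₀, h₀⟩ := hQ
  -- `φ₀ = θ v₀`, `ψ₀ = θ w₀` have `Q^∨(φ₀, ψ₀) = Q(v₀, w₀) ≠ 0`
  set φ₀ := Q.toDualEquiv v₀ with hφ₀
  set ψ₀ := Q.toDualEquiv w₀ with hψ₀
  have hd₀ : Q.dualForm φ₀ ψ₀ = Q.form v₀ w₀ := by
    rw [Q.dualForm_apply, hφ₀, hψ₀, LinearEquiv.symm_apply_apply, LinearEquiv.symm_apply_apply]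
  have hne : Q.dualForm φ₀ ψ₀ ≠ 0 := hd₀ ▸ h₀
  refine ⟨(Q.dualForm (φ₀ ∘ₗ X) ψ₀ + Q.dualForm φ₀ (ψ₀ ∘ₗ X)) / Q.dualForm φ₀ ψ₀, fun v w => ?_⟩
  have key := Q.dualForm_mul_form_add_eq_of_mem_mumfordTateLieAlgebra hX φ₀ ψ₀ v w
  field_simp
  linear_combination key

/-- **`𝔪𝔱 = (𝔪𝔱 ∩ 𝔰𝔭(Q)) + ℚ·id` in nonzero weight**: for `X ∈ 𝔪𝔱(H)`, `n ≠ 0`, there is `c ∈ ℚ` such that `X − c·id` is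
`Q`-skew (`Q((X − c)v, w) + Q(v, (X − c)w) = 0`) and again lies in `𝔪𝔱(H)` (`id ∈ 𝔪𝔱`, Deligne I 3.4).
[cite: Deligne1982HodgeCycles, I Prop. 3.4 and Prop. 3.6 (proof)] -/
theorem Polarization.exists_sub_smul_id_skew_of_mem_mumfordTateLieAlgebra (Q : Polarization H) (hn : n ≠ 0)
    {X : Module.End ℚ V} (hX : X ∈ H.mumfordTateLieAlgebra) :
    ∃ c : ℚ, (X - c • (LinearMap.id : Module.End ℚ V)) ∈ H.mumfordTateLieAlgebra ∧
      ∀ v w, Q.form ((X - c • (LinearMap.id : Module.End ℚ V)) v) w +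
        Q.form v ((X - c • (LinearMap.id : Module.End ℚ V)) w) = 0 := by
  obtain ⟨c, hc⟩ := Q.exists_form_add_form_eq_mul_of_mem_mumfordTateLieAlgebra hX
  refine ⟨c / 2, Submodule.sub_mem _ hX (Submodule.smul_mem _ _ (id_mem_mumfordTateLieAlgebra H hn)), fun v w => ?_⟩
  simp only [LinearMap.sub_apply, LinearMap.smul_apply, LinearMap.id_apply, map_sub, map_smul, LinearMap.sub_apply,
    LinearMap.smul_apply, smul_eq_mul]
  rw [show Q.form (X v) w - c / 2 * Q.form v w + (Q.form v (X w) - c / 2 * Q.form v w) =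
      (Q.form (X v) w + Q.form v (X w)) - c * Q.form v w by ring, hc, sub_self]

end HodgeStructure

end Literature.AlgebraicGeometry.Motives

end
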